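import Summits.BirchSwinnertonDyer.BirchSwinnertonDyer.Theses.CumulativeHeegnerLeopoldt
import Summits.BirchSwinnertonDyer.BirchSwinnertonDyer.Theorems.EisensteinPrimesResidualCharacterSelmerFiniteOfFact
import Literature.NumberTheory.EllipticCurves.CastellaGrossiLeeSkinner2022.KatzPAdicLFunctionExistence
import HarnessLib

/-!
# Route `CumulativeHeegnerLeopoldt`, the two Eisenstein character-invariant cruxes K2 `EisensteinCharacterInvariantsAtThree`
# (aside stmt-BirchSwinnertonDyer-24199) and K2-odd `EisensteinCharacterInvariantsAtThreeOdd` (crux stmt-BirchSwinnertonDyer-23970):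
# the ODD-DISCRIMINANT CUT IS EXACT — K2 ⟹ K2-odd outright, K2 ⟺ K2-odd ∧ EVEN (EVEN = the registered stub
# `stub_evenDiscriminant` of 24199's line `birth` v5, VERBATIM), and 24199's print stub re-keyed onto CGLS Prop. 1.2.5
# (helper, `--supports stmt-BirchSwinnertonDyer-24199`)

Prover `leafhand-bsd-cumulativeheegnerl-2` g0 (cell `bsd-eis`). Crux 23970 is the text of aside 24199 with ONE binder
`Odd (NumberField.discr K) →` inserted after the Heegner hypothesis (route rev 7; vet-chl-odd g0 / print-x9-ref g8 read-backs); line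
`birth` v5 of 24199 (skeleton a938f29ff5eb8691) carries the complementary scope stub EVEN `stub_evenDiscriminant` (the same text with
`¬ Odd (NumberField.discr K) →`), idle for the route by design. This file records, BY NAME on the route decls:

* `eisensteinCharacterInvariantsAtThreeOdd_of_atThree` — K2 (24199) ⟹ K2-odd (23970), no input: every closer of 24199 closes 23970;
* `eisensteinCharacterInvariantsAtThree_of_odd_of_even` / `eisensteinCharacterInvariantsAtThree_iff_odd_and_even` — K2 ⟺ K2-odd ∧ EVEN:
  the partition of 24199 into crux 23970 and the registered scope stub is LOSSLESS (the skeleton's case split, stated as an `iff`);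
* `stub_printedInputs_of_prop125` — 24199's registered print stub `stub_printedInputs` (CGLS Prop. 14 ∧ Thm. 2.1.2, VERBATIM) from CGLS
  Prop. 1.2.5 (module clause) ∧ Thm. 2.1.2, Prop. 14 ⟸ Prop. 1.2.5 being kernel
  (`TeichmullerPairUnramifiedAtMult.prop14_residualCharacter_selmer_finite_of_fact`), so that 24199's print ledger is keyed on the SAME
  CGLS conjunct as 23970's ALG-PRINT and 24198's P (one name for the three items).

HONEST FRAMING: bookkeeping theorems (binder shuffles and one composition of a tree theorem); no definition, no named fact introduced,
no `sorry`; no stub is closed by name (EVEN is as hard as K2 at even `d_K`; the print stub keeps two unproved published facts); items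
23970 / 24199 stay OPEN. BSD is not proved for any curve.
References: [CastellaGrossiLeeSkinner2022] §1.2 Prop. 1.2.5, Prop. 14, §2 Thm. 2.1.2; route file rev 7 (23970), skeleton a938f29ff5eb8691 (24199).
-/

set_option linter.dupNamespace false
set_option autoImplicit false

noncomputable section

namespace Summit.BirchSwinnertonDyer.BirchSwinnertonDyer.Theorems.EisensteinCharacterInvariantsAtThreeOddCutExact

open Summit.BirchSwinnertonDyer.BirchSwinnertonDyer.Theses.CumulativeHeegnerLeopoldt
  Literature.NumberTheory.EllipticCurves.CastellaGrossiLeeSkinner2022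

/-- **K2 ⟹ K2-odd** (aside 24199 ⟹ crux 23970): forget the binder `Odd (NumberField.discr K)`. Unconditional.
[cite: CastellaGrossiLeeSkinner2022, §1.2 Prop. 14] -/
theorem eisensteinCharacterInvariantsAtThreeOdd_of_atThree (h : EisensteinCharacterInvariantsAtThree) :
    EisensteinCharacterInvariantsAtThreeOdd := by
  intro W _ _ N _ K _ _ Dt hO6 hRed hcell hr hN hK hHg _hodd
  exact h W N K Dt hO6 hRed hcell hr hN hK hHg

/-- **K2 ⟸ K2-odd ∧ EVEN** (EVEN = the registered stub `stub_evenDiscriminant` of 24199's line `birth` v5, VERBATIM): the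
skeleton's case split on `Odd (NumberField.discr K)`, stated on the route decls. Unconditional implication between statements;
closes nothing. [cite: CastellaGrossiLeeSkinner2022, §1.2 Prop. 14] -/
theorem eisensteinCharacterInvariantsAtThree_of_odd_of_even (hodd : EisensteinCharacterInvariantsAtThreeOdd)
    (heven : ∀ (W : WeierstrassCurve ℚ) [W.IsElliptic] [W.IsGloballyMinimal] (N : ℕ) [NeZero N] (K : Type) [Field K] [NumberField K] (Dt : Literature.NumberTheory.EllipticCurves.ModularForms.ModularParametrizationData W N), Summit.BirchSwinnertonDyer.Rank1Residual.Additive.ClassO6 W 3 → Literature.NumberTheory.EllipticCurves.Rank1Residual.Red W 3 → (∃ Φ : AddSubgroup (WeierstrassCurve.geomTorsion W ((3 : ℕ) : ℤ)), Literature.NumberTheory.EllipticCurves.Rank1Residual.IsRationalLine W 3 Φ ∧ ∀ (v : IsDedekindDomain.HeightOneSpectrum (NumberField.RingOfIntegers ℚ)), ((3 : ℕ) : NumberField.RingOfIntegers ℚ) ∈ v.asIdeal → ∀ 𝔓 ∈ v.primesAbove, ¬ (∀ g ∈ 𝔓.decompositionSubgroup (Field.absoluteGaloisGroup ℚ), ∀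 P ∈ Φ, g • P = P) ∧ ¬ (∀ g ∈ 𝔓.decompositionSubgroup (Field.absoluteGaloisGroup ℚ), ∀ P : WeierstrassCurve.geomTorsion W ((3 : ℕ) : ℤ), g • P - P ∈ Φ)) → W.analyticRank = 1 → W.conductorNorm ℤ = N → Literature.NumberTheory.EllipticCurves.IsImaginaryQuadratic K → Literature.NumberTheory.EllipticCurves.SatisfiesHeegnerHypothesis N K → ¬ Odd (NumberField.discr K) → ∀ (κ : Literature.NumberTheory.EllipticCurves.ZpExtension K 3), κ.IsAnticyclotomic → ∀ (γ : Field.absoluteGaloisGroup K) [Fact (κ.IsTopGenerator γ)] (𝔭 : IsDedekindDomain.HeightOneSpectrum (NumberField.RingOfIntegers K)), ((3 : ℕ) : NumberField.RingOfIntegers K) ∈ 𝔭.asIdeal → 𝔭.asIdeal.ramificationIdx (NumberField.RingOfIntegers ℚ) = 1 → 𝔭.asIdeal.inertiaDeg (NumberField.RingOfIntegers ℚ) = 1 → ∀ (𝔭' : IsDedekindDomain.HeightOneSpectrum (NumberField.RingOfIntegers K)), ((3 : ℕ) : NumberField.RingOfIntegers K) ∈ 𝔭'.asIdeal → 𝔭'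 ≠ 𝔭 → ∀ (ι' : PadicAlgCl 3 ≃+* ℂ), Summit.BirchSwinnertonDyer.BirchSwinnertonDyer.Theorems.SchneiderFree.BranchInducesPrime 3 ι' 𝔭 → ∀ (ΩK : ℂ) (Ωp : ℂ_[3]) (L : Literature.NumberTheory.EllipticCurves.UnrSeries 3), ΩK ≠ 0 → Ωp ≠ 0 → Literature.NumberTheory.EllipticCurves.IsBDPLFunction ι' 𝔭 κ γ Dt.f ΩK Ωp L → ∃ (g : Literature.NumberTheory.EllipticCurves.UnrSeries 3) (n : ℕ), (Summit.BirchSwinnertonDyer.Rank1Residual.X11b.AcSelmer.XAc.charIdeal (W.baseChange K) 3 κ 𝔭' ∅ γ).map (PowerSeries.map (Summit.BirchSwinnertonDyer.Rank1Residual.X11b.Halves.toUnr 3)) = Ideal.span {g} ∧ (∀ i < n, ‖((PowerSeries.coeff i g : Literature.NumberTheory.EllipticCurves.unrIntegers 3) : ℂ_[3])‖ < 1) ∧ ‖((PowerSeries.coeff n g : Literature.NumberTheory.EllipticCurves.unrIntegers 3) : ℂ_[3])‖ = 1 ∧ (∀ i < n, ‖((PowerSeries.coeff i L : Literature.NumberTheory.EllipticCurves.unrIntegers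 3) : ℂ_[3])‖ < 1) ∧ ‖((PowerSeries.coeff n L : Literature.NumberTheory.EllipticCurves.unrIntegers 3) : ℂ_[3])‖ = 1) :
    EisensteinCharacterInvariantsAtThree := by
  intro W _ _ N _ K _ _ Dt hO6 hRed hcell hr hN hK hHg
  by_cases ho : Odd (NumberField.discr K)
  · exact hodd W N K Dt hO6 hRed hcell hr hN hK hHg ho
  · exact heven W N K Dt hO6 hRed hcell hr hN hK hHg ho

/-- **K2 ⟺ K2-odd ∧ EVEN**: the partition of aside 24199 into crux 23970 and the registered scope stub
`stub_evenDiscriminant` is lossless. Unconditional; closes nothing. [cite: CastellaGrossiLeeSkinner2022, §1.2 Prop. 14] -/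
theorem eisensteinCharacterInvariantsAtThree_iff_odd_and_even :
    EisensteinCharacterInvariantsAtThree ↔
      (EisensteinCharacterInvariantsAtThreeOdd ∧
        (∀ (W : WeierstrassCurve ℚ) [W.IsElliptic] [W.IsGloballyMinimal] (N : ℕ) [NeZero N] (K : Type) [Field K] [NumberField K] (Dt : Literature.NumberTheory.EllipticCurves.ModularForms.ModularParametrizationData W N), Summit.BirchSwinnertonDyer.Rank1Residual.Additive.ClassO6 W 3 → Literature.NumberTheory.EllipticCurves.Rank1Residual.Red W 3 → (∃ Φ : AddSubgroup (WeierstrassCurve.geomTorsion W ((3 : ℕ) : ℤ)), Literature.NumberTheory.EllipticCurves.Rank1Residual.IsRationalLine W 3 Φ ∧ ∀ (v : IsDedekindDomain.HeightOneSpectrum (NumberField.RingOfIntegers ℚ)), ((3 : ℕ) : NumberField.RingOfIntegers ℚ) ∈ v.asIdeal → ∀ 𝔓 ∈ v.primesAbove, ¬ (∀ g ∈ 𝔓.decompositionSubgroup (Field.absoluteGaloisGroup ℚ), ∀ P ∈ Φ, g • P = P) ∧ ¬ (∀ g ∈ 𝔓.decompositionSubgroup (Field.absoluteGaloisGroup ℚ),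 ∀ P : WeierstrassCurve.geomTorsion W ((3 : ℕ) : ℤ), g • P - P ∈ Φ)) → W.analyticRank = 1 → W.conductorNorm ℤ = N → Literature.NumberTheory.EllipticCurves.IsImaginaryQuadratic K → Literature.NumberTheory.EllipticCurves.SatisfiesHeegnerHypothesis N K → ¬ Odd (NumberField.discr K) → ∀ (κ : Literature.NumberTheory.EllipticCurves.ZpExtension K 3), κ.IsAnticyclotomic → ∀ (γ : Field.absoluteGaloisGroup K) [Fact (κ.IsTopGenerator γ)] (𝔭 : IsDedekindDomain.HeightOneSpectrum (NumberField.RingOfIntegers K)), ((3 : ℕ) : NumberField.RingOfIntegers K) ∈ 𝔭.asIdeal → 𝔭.asIdeal.ramificationIdx (NumberField.RingOfIntegers ℚ) = 1 → 𝔭.asIdeal.inertiaDeg (NumberField.RingOfIntegers ℚ) = 1 → ∀ (𝔭' : IsDedekindDomain.HeightOneSpectrum (NumberField.RingOfIntegers K)), ((3 : ℕ) : NumberField.RingOfIntegers K) ∈ 𝔭'.asIdeal → 𝔭' ≠ 𝔭 → ∀ (ι' : PadicAlgCl 3 ≃+* ℂ), Summit.BirchSwinnertonDyer.BirchSwinnertonDyer.Theorems.SchneiderFree.BranchInducesPrime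 3 ι' 𝔭 → ∀ (ΩK : ℂ) (Ωp : ℂ_[3]) (L : Literature.NumberTheory.EllipticCurves.UnrSeries 3), ΩK ≠ 0 → Ωp ≠ 0 → Literature.NumberTheory.EllipticCurves.IsBDPLFunction ι' 𝔭 κ γ Dt.f ΩK Ωp L → ∃ (g : Literature.NumberTheory.EllipticCurves.UnrSeries 3) (n : ℕ), (Summit.BirchSwinnertonDyer.Rank1Residual.X11b.AcSelmer.XAc.charIdeal (W.baseChange K) 3 κ 𝔭' ∅ γ).map (PowerSeries.map (Summit.BirchSwinnertonDyer.Rank1Residual.X11b.Halves.toUnr 3)) = Ideal.span {g} ∧ (∀ i < n, ‖((PowerSeries.coeff i g : Literature.NumberTheory.EllipticCurves.unrIntegers 3) : ℂ_[3])‖ < 1) ∧ ‖((PowerSeries.coeff n g : Literature.NumberTheory.EllipticCurves.unrIntegers 3) : ℂ_[3])‖ = 1 ∧ (∀ i < n, ‖((PowerSeries.coeff i L : Literature.NumberTheory.EllipticCurves.unrIntegers 3) : ℂ_[3])‖ < 1) ∧ ‖((PowerSeries.coeff n L : Literature.NumberTheory.EllipticCurves.unrIntegers 3) : ℂ_[3])‖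 = 1)) := by
  refine ⟨fun h ↦ ⟨eisensteinCharacterInvariantsAtThreeOdd_of_atThree h, ?_⟩,
    fun h ↦ eisensteinCharacterInvariantsAtThree_of_odd_of_even h.1 h.2⟩
  intro W _ _ N _ K _ _ Dt hO6 hRed hcell hr hN hK hHg _heven
  exact h W N K Dt hO6 hRed hcell hr hN hK hHg

/-- **24199's registered print stub `stub_printedInputs` (CGLS 2022 Prop. 14 ∧ Thm. 2.1.2, VERBATIM) from CGLS Prop. 1.2.5's module
clause and Thm. 2.1.2** — Prop. 14 ⟸ Prop. 1.2.5 in the kernel. CONDITIONAL on two published facts typed as `Prop`s; closes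
nothing by name. [cite: CastellaGrossiLeeSkinner2022, §1.2 Prop. 1.2.5, Prop. 14, §2.1 Thm. 2.1.2] -/
theorem stub_printedInputs_of_prop125 (hprop125 : prop125_characterGrSelmerDual_torsion_muZero_dim)
    (hkatz : thm212_exists_isKatzLFunction) :
    Literature.NumberTheory.EllipticCurves.CastellaGrossiLeeSkinner2022.prop14_residualCharacterSelmer_finite ∧
      Literature.NumberTheory.EllipticCurves.CastellaGrossiLeeSkinner2022.thm212_exists_isKatzLFunction :=
  ⟨TeichmullerPairUnramifiedAtMult.prop14_residualCharacterSelmer_finite_of_fact hprop125, hkatz⟩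

end Summit.BirchSwinnertonDyer.BirchSwinnertonDyer.Theorems.EisensteinCharacterInvariantsAtThreeOddCutExact

end
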